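import Summits.Langlands.Langlands.Theorems.IrreducibilityBySelfDualityPairLBoundaryJSCornerGlobal
import Summits.Langlands.Langlands.Theorems.IrreducibilityBySelfDualityPairLBoundaryJSGapProjectedCornerChar
import Literature.NumberTheory.Automorphic.JPSSProjectedGlobalIntegral

/-!
# The GLOBAL projected theorem: the `GL_n × GL_m` integral WITH the projector unfolded to the torus
# (Cogdell (2004), §2.2.1–2.2, Thm. 2.1, Eulerian clause, general `m < n`)

Summit `Langlands`, sub-problem `Langlands`, helper file under `Theorems/` supporting the crux `PairLBoundaryJS`
(stmt-Langlands-13622), line `Sketch`, wave 3 (projector road, lead c6), registered sub-stub `stub_gap_proj_global`: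
the `GL_n × GL_m` analogue of `CornerGlobal.jpssIntegral_eq_mul_integral_torusPairIntegrandC`. For `0 < m < n`, an
automorphic measure `μ'` on `X_m`, Haar measures `νA`, `νK`, there is `C > 0` such that for all honest cusp forms `φ`
on `X_n`, `φ'` on `X_m` whose pair satisfies the decay hypothesis (H2) of the projector road and every torus
parameter `s` at which the one-factor torus integral of `|W_Φ ∘ ι|` is finite,

  `I^ℙ(s + (n-m)/2; φ, φ') = C · ∫ W_Φ(ι(ak)) conj (W_{Φ̄'}(ak)) |det a|^s δ_B(a)⁻¹ d(νA ⊗ νK)`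

(`I^ℙ = jpssProjIntegral`, the integral of Cogdell's projection `ℙⁿ_m φ = |det|^{-(n-m-1)/2} Φ_m` against `φ'`,
`Φ_m = whittakerDepth m (invQuot φ)`; `W = whittakerDepth 0`, Tate's character; `ι = glCorner (m ≤ n)`). The two
unfolding bricks specific to the projector — the quotient-to-group unfolding of `I^ℙ` with a `GL_m(K)`-covering weight
(`GapProjectedQuotientUnfolding`) and the insertion of the expansion of `Φ_m` along `N_m(K)\GL_m(K)`
(`GapProjectedWhittakerUnfolding`) — enter as the HYPOTHESES `hQU`, `hWU` of `exists_const_projected_of` (stated in the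
shape those files prove), so that this assembly lands independently; the rest is the corner assembly verbatim at
general corank: `N_m(K)\N_m(𝔸)` first (`integral_mul_mul_toReal_eq_integral_mul_conj_whittakerDepth`), the Iwasawa
decomposition (`CornerBochnerIwasawa.stub_bochner_iwasawa`, `exists_lintegral_mul_rpow_mul_weight_eq_mul_lintegral_prod`)
and the generic character along the corner at general corank (`GapProjectedCornerChar`).

## References

* J. W. Cogdell, *Analytic theory of L-functions for GL_n* (2004), §2.2 (PDF pp. 181–184), Thm. 2.1
  [CogdellAnalyticTheory2004].
* H. Jacquet, I. I. Piatetski-Shapiro, J. Shalika, *Rankin–Selberg convolutions*, Amer. J. Math. 105 (1983), §2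
  [JacquetPiatetskiShapiroShalika1983].
-/

noncomputable section

-- `Summit.Langlands.Langlands.…` (summit = sub-problem name, D-0017 layout) trips `dupNamespace`
set_option linter.dupNamespace false

open scoped MatrixGroups Topology Pointwise ENNReal NNReal ComplexConjugate InnerProductSpace ContDiff
-- the place subtypes indexing `mixedSpace K` are `Fintype` classically (`NormedCommRing (mixedSpace K)`)
open scoped Classical Matrix.Norms.Operator
open NumberField IsDedekindDomain MeasureTheory Measure Matrix Set Filter WithZero
open NumberField.mixedEmbedding
open Literature.NumberTheory.Automorphic AdelicGroupData
open Literature.NumberTheory.GaloisRepresentations (ideleGroup HeckeCharacter)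
open Literature.MeasureTheory.Group
open Literature.RingTheory.SymmetricFunctions.SymmPoly
open ValuativeRel

-- the automorphic quotient carries the tree's Borel σ-algebra, not Mathlib's quotient σ-algebra
attribute [-instance] Quotient.instMeasurableSpace QuotientGroup.measurableSpace

-- the house local instances, exactly as in `RankinSelbergUnfoldingIdentity`
attribute [local instance] adelicBorel borelSpace_adelic locallyCompactSpace_adelic secondCountableTopology_gl_adelic
  glAdeleBorel borelSpace_glAdele borelSpace_ideleGroup secondCountableTopology_ideleGroup

-- Mathlib idiom: the commutator Lie ring on matrices, to mention `(archGroupGL n K).lie`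
attribute [local instance 100] LieRing.ofAssociativeRing

namespace Summit.Langlands.Langlands.Theorems.GapProjectedGlobal

open GapProjectedCornerChar

section Main

variable {n m : ℕ} {K : Type} [Field K] [NumberField K]
  [MeasurableSpace (AdeleRing (𝓞 K) K)] [BorelSpace (AdeleRing (𝓞 K) K)]

local notation "𝔸" => AdeleRing (𝓞 K) K

/-- **The global projected theorem, granted the two projector unfolding bricks** (Cogdell (2004), §2.2.1–2.2,
Thm. 2.1, Eulerian clause, `m < n`). Hypotheses: `hQU` — the quotient-to-group unfolding of `I^ℙ` with a
`GL_m(K)`-covering weight (shape of `GapProjectedQuotientUnfolding`), `hWU` — the insertion of the expansion of `Φ_m`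
along `N_m(K)\GL_m(K)` (shape of `GapProjectedWhittakerUnfolding`). Conclusion: there is `C > 0` with, for honest cusp
forms `φ`, `φ'` satisfying (H2) and every torus parameter `s` of finite one-factor torus integral,
`I^ℙ(s + (n-m)/2; φ, φ') = C ∫ torusPairIntegrandC m K (W_Φ ∘ ι) (conj ∘ W_{Φ̄'}) 1 s`.
[cite: CogdellAnalyticTheory2004, §2.2 (PDF pp. 182–183), Thm. 2.1] -/
theorem exists_const_projected_of (hm : 0 < m) (hmn : m < n)
    (μ' : Measure (AdelicGroupData.gl m K).automorphicQuotient) [(AdelicGroupData.gl m K).IsAutomorphicMeasure μ']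
    (νA : Measure (Fin m → ideleGroup K)) [IsHaarMeasure νA]
    (νK : Measure ↥(maximalCompactAdelic m K)) [IsHaarMeasure νK]
    (hQU : ∀ (ν : Measure (GL (Fin m) 𝔸)) [ν.IsHaarMeasure], ∃ C : ℝ, 0 < C ∧
      ∀ {φ : (AdelicGroupData.gl n K).automorphicQuotient → ℂ},
        IsCuspFormGL n K (isCompact_glFiniteIntegralLevel_holds n K) (invQuot (AdelicGroupData.gl n K) φ) →
      ∀ {φ' : (AdelicGroupData.gl m K).automorphicQuotient → ℂ},
        IsCuspFormGL m K (isCompact_glFiniteIntegralLevel_holds m K) (invQuot (AdelicGroupData.gl m K) φ') →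
      (∀ B : ℝ, 0 < B → ∃ C : ℝ, 0 ≤ C ∧ ∀ h : GL (Fin m) 𝔸,
        ‖whittakerDepth m (invQuot (AdelicGroupData.gl n K) φ) (glCorner 𝔸 hmn.le h)‖ *
            ‖invQuot (AdelicGroupData.gl m K) φ' h‖ ≤
          C * min ((((glAbsDet m K h : ℝ≥0ˣ) : ℝ≥0) : ℝ) ^ B) ((((glAbsDet m K h : ℝ≥0ˣ) : ℝ≥0) : ℝ) ^ (-B))) →
      ∀ (β : (AdelicGroupData.gl m K).Adelic → ℝ≥0∞), IsCoveringWeight ↥(AdelicGroupData.gl m K).arithmeticSubgroup β →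
      ∀ s : ℂ, jpssProjIntegral hmn μ' φ φ' s =
        (C : ℂ) * ∫ g, whittakerDepth m (invQuot (AdelicGroupData.gl n K) φ) (glCorner 𝔸 hmn.le g) *
          invQuot (AdelicGroupData.gl m K) φ' g *
          ((((glAbsDet m K g : ℝ≥0ˣ) : ℝ≥0) : ℝ) : ℂ) ^ (s - ((n : ℂ) - (m : ℂ)) / 2) * ((β g).toReal : ℂ) ∂ν)
    (hWU : ∀ (ν : Measure (GL (Fin m) 𝔸)) [ν.IsHaarMeasure] {Φ : GL (Fin n) 𝔸 → ℂ},
      IsCuspFormGL n K (isCompact_glFiniteIntegralLevel_holds n K) Φ →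
      ∀ {Θ : GL (Fin m) 𝔸 → ℂ}, Measurable Θ → (∀ (γ₀ : GL (Fin m) K) (x : GL (Fin m) 𝔸), Θ (ratGL K γ₀ * x) = Θ x) →
      ∀ {β β' : GL (Fin m) 𝔸 → ℝ≥0∞}, Measurable β →
      (∀ x, coveringSum ↥(ratPoints (⊤ : Subgroup (GL (Fin m) K))) β x = 1) →
      Measurable β' → (∀ x, coveringSum ↥(ratPoints (tailUnipotent m K 0)) β' x = 1) →
      ∫⁻ x, ‖whittakerDepth 0 Φ (glCorner 𝔸 hmn.le x) * Θ x‖ₑ * β' x ∂ν < ⊤ →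
      ∫ x, whittakerDepth 0 Φ (glCorner 𝔸 hmn.le x) * Θ x * ((β' x).toReal : ℂ) ∂ν =
        ∫ x, whittakerDepth m Φ (glCorner 𝔸 hmn.le x) * Θ x * ((β x).toReal : ℂ) ∂ν) :
    ∃ C : ℝ, 0 < C ∧
      ∀ {φ : (AdelicGroupData.gl n K).automorphicQuotient → ℂ},
        IsCuspFormGL n K (isCompact_glFiniteIntegralLevel_holds n K) (invQuot (AdelicGroupData.gl n K) φ) →
      ∀ {φ' : (AdelicGroupData.gl m K).automorphicQuotient → ℂ},
        IsCuspFormGL m K (isCompact_glFiniteIntegralLevel_holds m K) (invQuot (AdelicGroupData.gl m K) φ') →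
      (∀ B : ℝ, 0 < B → ∃ C : ℝ, 0 ≤ C ∧ ∀ h : GL (Fin m) 𝔸,
        ‖whittakerDepth m (invQuot (AdelicGroupData.gl n K) φ) (glCorner 𝔸 hmn.le h)‖ *
            ‖invQuot (AdelicGroupData.gl m K) φ' h‖ ≤
          C * min ((((glAbsDet m K h : ℝ≥0ˣ) : ℝ≥0) : ℝ) ^ B) ((((glAbsDet m K h : ℝ≥0ˣ) : ℝ≥0) : ℝ) ^ (-B))) →
      ∀ (s : ℂ),
        ∫⁻ p, ‖whittakerDepth 0 (invQuot (AdelicGroupData.gl n K) φ) (glCorner 𝔸 hmn.le (torusPoint m K p))‖ₑ *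
            ENNReal.ofReal (torusWeight m K s.re p.1) ∂(νA.prod νK) < ⊤ →
        jpssProjIntegral hmn μ' φ φ' (s + ((n : ℂ) - (m : ℂ)) / 2) =
          (C : ℂ) * ∫ p, torusPairIntegrandC m K
            (fun g => whittakerDepth 0 (invQuot (AdelicGroupData.gl n K) φ) (glCorner 𝔸 hmn.le g))
            (fun g => conj (whittakerDepth 0 (fun x => conj (invQuot (AdelicGroupData.gl m K) φ' x)) g))
            (fun _ => (1 : ℝ)) s p ∂(νA.prod νK) := by
  have hn : 0 < n := hm.trans hmn
  -- a Haar measure `ν` on `G = GL_m(𝔸_K)`, a Haar measure in both spellings of the Borel structure of `G`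
  haveI : T2Space (GL (Fin m) 𝔸) := t2Space_gl m K
  haveI : LocallyCompactSpace (GL (Fin m) 𝔸) := AdelicGroupData.locallyCompactSpace_generalLinearGroup_adeleRing K (Fin m)
  haveI : SecondCountableTopology (GL (Fin m) 𝔸) := secondCountableTopology_generalLinearGroup_adeleRing K (Fin m)
  set ν : Measure (GL (Fin m) 𝔸) := Measure.haar with hν
  haveI hνH : IsHaarMeasure ν := inferInstance
  haveI : @Measure.IsHaarMeasure (AdelicGroupData.gl m K).Adelic (AdelicGroupData.gl m K).adGroup
      (AdelicGroupData.gl m K).adTop (adelicBorel m K) ν := hνH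
  -- the constants of the bricks; a `GL_m(K)`-covering weight `β` and an `N_m(K)`-covering weight `β'`
  obtain ⟨C₂, hC₂, h2⟩ := hQU ν
  obtain ⟨C₅, hC₅, h5⟩ := CornerBochnerIwasawa.stub_bochner_iwasawa hm ν νA νK
  obtain ⟨Cι, -, hCιtop, hι⟩ := exists_lintegral_mul_rpow_mul_weight_eq_mul_lintegral_prod (K := K) hm ν νA νK
  obtain ⟨β, hβ⟩ := exists_isCoveringWeight_ratPoints (n := m) (K := K) (⊤ : Subgroup (GL (Fin m) K))
  obtain ⟨β', hβ'⟩ := exists_isCoveringWeight_ratPoints (n := m) (K := K) (tailUnipotent m K 0)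
  have hβA := hβ; rw [ratPoints_top_eq_arithmeticSubgroup] at hβA
  refine ⟨C₂ * C₅, mul_pos hC₂ hC₅, fun {φ} hφ {φ'} hφ' hdec s hfin => ?_⟩
  set sh : ℂ := ((n : ℂ) - (m : ℂ)) / 2 with hsh
  -- the classical functions `Φ`, `Φ'`: continuous, `A_G`-invariant (hence bounded)
  have hΦc : Continuous (invQuot (AdelicGroupData.gl n K) φ) := hφ.1.continuous_gl
  have hΦ'c : Continuous (invQuot (AdelicGroupData.gl m K) φ') := hφ'.1.continuous_gl
  have hΦ'A : ∀ z ∈ (AdelicGroupData.gl m K).center', ∀ g : (AdelicGroupData.gl m K).Adelic,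
      invQuot (AdelicGroupData.gl m K) φ' (z * g) = invQuot (AdelicGroupData.gl m K) φ' g :=
    fun z hz g => invQuot_mul_left _ φ' (Subgroup.mem_sup_left hz) g
  have hB2 := h2 hφ hφ' hdec β hβA (s + sh)
  obtain ⟨M, hM⟩ := hφ'.bounded_of_center' hΦ'A
  set Φ : GL (Fin n) 𝔸 → ℂ := invQuot (AdelicGroupData.gl n K) φ with hΦdef
  set Φ' : GL (Fin m) 𝔸 → ℂ := invQuot (AdelicGroupData.gl m K) φ' with hΦ'def
  have hΦK : ∀ (γ₀ : GL (Fin n) K) (x : GL (Fin n) 𝔸), Φ (ratGL K γ₀ * x) = Φ x :=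
    fun γ₀ x => hφ.1.leftInvariant _ (show ratGL K γ₀ ∈ rationalPointsGL n K from ⟨γ₀, rfl⟩) x
  have hΦ'K : ∀ (γ₀ : GL (Fin m) K) (x : GL (Fin m) 𝔸), Φ' (ratGL K γ₀ * x) = Φ' x :=
    fun γ₀ x => hφ'.1.leftInvariant _ (show ratGL K γ₀ ∈ rationalPointsGL m K from ⟨γ₀, rfl⟩) x
  -- the Whittaker functions `W = W_Φ` on `GL_n(𝔸_K)` and `W' = W_{Φ̄'}` on `GL_m(𝔸_K)` (bounded by `M`)
  set W : GL (Fin n) 𝔸 → ℂ := whittakerDepth 0 Φ with hWdef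
  set W' : GL (Fin m) 𝔸 → ℂ := whittakerDepth 0 (fun x => conj (Φ' x)) with hW'def
  have hW'b : ∀ g : GL (Fin m) 𝔸, ‖conj (W' g)‖ ≤ M := fun g => by
    rw [Complex.norm_conj]; exact norm_whittakerDepth_le (fun z => by rw [Complex.norm_conj]; exact hM z) 0 g
  have hW'c : Continuous W' := continuous_whittakerDepth (Complex.continuous_conj.comp hΦ'c) 0
  have hWιm : Measurable fun x : GL (Fin m) 𝔸 => W (glCorner 𝔸 hmn.le x) :=
    ((continuous_whittakerDepth hΦc 0).comp (continuous_glCorner _)).measurable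
  -- the quasi-character `D = |det|_𝔸^{s}` and its modulus `r = |det|_𝔸^{re s}`
  set r : GL (Fin m) 𝔸 → ℝ := fun x =>
    ((IdeleClassGroup.ideleNorm K (Matrix.GeneralLinearGroup.det x) : ℝ≥0) : ℝ) ^ s.re with hr
  set D : GL (Fin m) 𝔸 → ℂ := fun x =>
    ((((IdeleClassGroup.ideleNorm K (Matrix.GeneralLinearGroup.det x) : ℝ≥0) : ℝ) : ℂ)) ^ s with hD
  have hDm : Measurable D := (Complex.measurable_ofReal.comp (measurable_subtype_coe.comp
    ((continuous_ideleNorm_holds K).measurable.comp Matrix.GeneralLinearGroup.continuous_det.measurable))).pow_const _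
  have hDn : ∀ x : GL (Fin m) 𝔸, ‖D x‖ = r x := fun x => by
    simp only [hD, hr]
    rw [Complex.norm_cpow_eq_rpow_re_of_pos (ideleNorm_coe_pos K _)]
  have hDu : ∀ u ∈ adelicColRange m K 1 (m - 1), ∀ x : GL (Fin m) 𝔸, D (u * x) = D x := fun u hu x => by
    simp only [hD, map_mul, ideleNorm_det_eq_one_of_mem_adelicColRange hu, one_mul]
  have hDK : ∀ (γ₀ : GL (Fin m) K) (x : GL (Fin m) 𝔸), D (ratGL K γ₀ * x) = D x := fun γ₀ x => by
    have h1 : IdeleClassGroup.ideleNorm K (Matrix.GeneralLinearGroup.det (ratGL K γ₀)) = 1 :=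
      ideleNorm_det_toAdelic m K γ₀
    simp only [hD, map_mul, h1, one_mul]
  -- `(N_m(𝔸), ψ)`-equivariance of `W ∘ ι` and of `W'`; `N_m(K)`-invariance of `Φ'`
  have hWu : ∀ u ∈ adelicColRange m K 1 (m - 1), ∀ x : GL (Fin m) 𝔸, W (glCorner 𝔸 hmn.le (u * x)) =
      (unipotentCharFrom (K := K) 1 u : ℂ) * W (glCorner 𝔸 hmn.le x) :=
    fun u hu x => whittakerDepth_zero_glCorner_colRange_mul hmn.le hn hΦK hu x
  have hW'u : ∀ u ∈ adelicColRange m K 1 (m - 1), ∀ x : GL (Fin m) 𝔸,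
      W' (u * x) = (unipotentCharFrom (K := K) 1 u : ℂ) * W' x := fun u hu x =>
    whittakerDepth_colRange_mul (fun γ₀ x => by rw [hΦ'K]) hm (by simpa only [zero_add] using hu) x
  have hΦ'N : ∀ (υ : ↥(rationalColRange m K 1 (m - 1))) (x : GL (Fin m) 𝔸),
      Φ' ((((υ : ↥(adelicColRange m K 1 (m - 1)))) : GL (Fin m) 𝔸) * x) = Φ' x := fun υ x => by
    obtain ⟨γ, hγ⟩ := (mem_rationalColRange_iff (υ : ↥(adelicColRange m K 1 (m - 1)))).1 υ.2
    rw [← hγ]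
    exact hΦ'K γ x
  -- the majorant `R(x) = |W(ι x)| |det x|^{re s} β'(x)` has finite integral (the `[0, ∞]` Iwasawa form)
  set R : GL (Fin m) 𝔸 → ℝ≥0∞ := fun x =>
    ‖W (glCorner 𝔸 hmn.le x)‖ₑ * ENNReal.ofReal (r x) * β' x with hR
  have hRL : ∫⁻ x, ENNReal.ofReal M * R x ∂ν < ⊤ := by
    have hF0u : ∀ u ∈ adelicColRange m K 1 (m - 1), ∀ x : GL (Fin m) 𝔸,
        ‖W (glCorner 𝔸 hmn.le (u * x))‖ₑ = ‖W (glCorner 𝔸 hmn.le x)‖ₑ := fun u hu x => by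
      rw [hWu u hu x, enorm_mul, ← ofReal_norm (unipotentCharFrom (K := K) 1 u : ℂ), Circle.norm_coe,
        ENNReal.ofReal_one, one_mul]
    have key := hι hWιm.enorm hF0u s.re hβ'.measurable hβ'.coveringSum_eq
    beta_reduce at key
    rw [lintegral_const_mul' _ _ ENNReal.ofReal_ne_top]
    refine ENNReal.mul_lt_top ENNReal.ofReal_lt_top ?_
    simp only [hR, hr]
    rw [key]
    exact ENNReal.mul_lt_top hCιtop.lt_top hfin
  have hβ'tm : Measurable fun x : GL (Fin m) 𝔸 => (((β' x).toReal : ℝ) : ℂ) :=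
    Complex.measurable_ofReal.comp hβ'.measurable.ennreal_toReal
  have hβ'e : ∀ x : GL (Fin m) 𝔸, ‖(((β' x).toReal : ℝ) : ℂ)‖ₑ ≤ β' x := fun x => by
    rw [← ofReal_norm, Complex.norm_real, Real.norm_eq_abs, abs_of_nonneg ENNReal.toReal_nonneg]
    exact ENNReal.ofReal_toReal_le
  have hdom : ∀ {G : GL (Fin m) 𝔸 → ℂ}, Measurable G → (∀ x, ‖G x‖ ≤ M) →
      Integrable (fun x => W (glCorner 𝔸 hmn.le x) * D x * G x * ((β' x).toReal : ℂ)) ν := by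
    intro G hGm hGb
    refine ⟨(((hWιm.mul hDm).mul hGm).mul hβ'tm).aestronglyMeasurable, lt_of_le_of_lt (lintegral_mono fun x => ?_) hRL⟩
    rw [enorm_mul]
    calc ‖W (glCorner 𝔸 hmn.le x) * D x * G x‖ₑ * ‖(((β' x).toReal : ℝ) : ℂ)‖ₑ
        ≤ ENNReal.ofReal M * (‖W (glCorner 𝔸 hmn.le x)‖ₑ * ENNReal.ofReal (r x)) * β' x :=
          mul_le_mul' (CornerGlobal.enorm_mul_mul_le (hDn x) (hGb x)) (hβ'e x)
      _ = ENNReal.ofReal M * R x := by simp only [hR]; ring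
  -- (B3) the Fourier–Whittaker expansion of `Φ_m` along the corner, `Θ = Φ' |det|^{s}`
  set Θ : GL (Fin m) 𝔸 → ℂ := fun x => Φ' x * D x with hΘ
  have hΘm : Measurable Θ := hΦ'c.measurable.mul hDm
  have hΘK : ∀ (γ₀ : GL (Fin m) K) (x : GL (Fin m) 𝔸), Θ (ratGL K γ₀ * x) = Θ x := fun γ₀ x => by
    simp only [hΘ, hΦ'K, hDK]
  have hint₃ : ∫⁻ x, ‖W (glCorner 𝔸 hmn.le x) * Θ x‖ₑ * β' x ∂ν < ⊤ := by
    refine lt_of_le_of_lt (lintegral_mono fun x => ?_) hRL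
    calc ‖W (glCorner 𝔸 hmn.le x) * Θ x‖ₑ * β' x
        = ‖W (glCorner 𝔸 hmn.le x) * D x * Φ' x‖ₑ * β' x := by
          simp only [hΘ]; rw [mul_comm (Φ' x) (D x), mul_assoc]
      _ ≤ ENNReal.ofReal M * (‖W (glCorner 𝔸 hmn.le x)‖ₑ * ENNReal.ofReal (r x)) * β' x :=
          mul_le_mul' (CornerGlobal.enorm_mul_mul_le (hDn x) (hM x)) le_rfl
      _ = ENNReal.ofReal M * R x := by simp only [hR]; ring
  have hB3 := hWU ν hφ hΘm hΘK hβ.measurable hβ.coveringSum_eq hβ'.measurable hβ'.coveringSum_eq hint₃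
  -- (B4) integration over `N_m(K)\N_m(𝔸)` first, `H = W(ι ·) |det|^{s}`
  set H : GL (Fin m) 𝔸 → ℂ := fun x => W (glCorner 𝔸 hmn.le x) * D x with hH
  have hHm : Measurable H := hWιm.mul hDm
  have hHu : ∀ (u : ↥(adelicColRange m K 1 (m - 1))) (x : GL (Fin m) 𝔸),
      H ((u : GL (Fin m) 𝔸) * x) = (unipotentCharFrom (K := K) 1 (u : GL (Fin m) 𝔸) : ℂ) * H x := fun u x => by
    simp only [hH]
    rw [hWu _ u.2 x, hDu _ u.2 x, mul_assoc]
  have hB4 := integral_mul_mul_toReal_eq_integral_mul_conj_whittakerDepth hm ν hHm hHu hΦ'c hM hΦ'N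
    hβ'.measurable hβ'.coveringSum_eq (hdom hΦ'c.measurable hM)
  -- (B5) the Iwasawa decomposition, `F = W(ι ·) conj W'` is left `N_m(𝔸)`-invariant (`|ψ_N| = 1`)
  set F : GL (Fin m) 𝔸 → ℂ := fun x => W (glCorner 𝔸 hmn.le x) * conj (W' x) with hF
  have hFm : Measurable F := hWιm.mul (Complex.continuous_conj.measurable.comp hW'c.measurable)
  have hFu : ∀ u ∈ adelicColRange m K 1 (m - 1), ∀ x : GL (Fin m) 𝔸, F (u * x) = F x := fun u hu x => by
    simp only [hF]
    rw [hWu u hu x, hW'u u hu x, map_mul, mul_mul_mul_comm, Complex.mul_conj, Circle.normSq_coe,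
      Complex.ofReal_one, one_mul]
  have hint₅ : Integrable (fun x => F x * D x * ((β' x).toReal : ℂ)) ν :=
    (hdom (Complex.continuous_conj.measurable.comp hW'c.measurable) hW'b).congr
      (Eventually.of_forall fun x => by simp only [hF, Function.comp_apply]; ring)
  have hB5 := (h5 hFm hFu s hβ'.measurable hβ'.coveringSum_eq hint₅).2
  -- assembly
  have hssh : s + sh - sh = s := add_sub_cancel_right s sh
  have e1 : ∀ g : GL (Fin m) 𝔸, whittakerDepth m Φ (glCorner 𝔸 hmn.le g) * Φ' g *
      ((((glAbsDet m K g : ℝ≥0ˣ) : ℝ≥0) : ℝ) : ℂ) ^ (s + sh - sh) * ((β g).toReal : ℂ) =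
        whittakerDepth m Φ (glCorner 𝔸 hmn.le g) * Θ g * ((β g).toReal : ℂ) := fun g => by
    rw [hssh, show ((((glAbsDet m K g : ℝ≥0ˣ) : ℝ≥0) : ℝ) : ℂ) ^ s = D g from rfl]
    simp only [hΘ]; ring
  have e7 : ∀ p, F (torusPoint m K p) * torusWeightC m K s p.1 = torusPairIntegrandC m K
      (fun g => W (glCorner 𝔸 hmn.le g)) (fun g => conj (W' g)) (fun _ => (1 : ℝ)) s p :=
    fun p => by simp only [hF, torusPairIntegrandC, Complex.ofReal_one, mul_one]
  calc jpssProjIntegral hmn μ' φ φ' (s + sh)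
      = (C₂ : ℂ) * ∫ x, whittakerDepth m Φ (glCorner 𝔸 hmn.le x) * Θ x * ((β x).toReal : ℂ) ∂ν := by
        rw [hB2]; congr 1; exact integral_congr_ae (Eventually.of_forall e1)
    _ = (C₂ : ℂ) * ∫ x, W (glCorner 𝔸 hmn.le x) * Θ x * ((β' x).toReal : ℂ) ∂ν := by rw [hB3]
    _ = (C₂ : ℂ) * ∫ x, H x * Φ' x * ((β' x).toReal : ℂ) ∂ν := by
        rw [integral_congr_ae (Eventually.of_forall fun x => show _ = H x * Φ' x * ((β' x).toReal : ℂ) by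
          simp only [hΘ, hH]; ring)]
    _ = (C₂ : ℂ) * ∫ x, H x * conj (W' x) * ((β' x).toReal : ℂ) ∂ν := by rw [hB4]
    _ = (C₂ : ℂ) * ∫ x, F x * D x * ((β' x).toReal : ℂ) ∂ν := by
        rw [integral_congr_ae (Eventually.of_forall fun x => show _ = F x * D x * ((β' x).toReal : ℂ) by
          simp only [hH, hF]; ring)]
    _ = (C₂ : ℂ) * ((C₅ : ℂ) * ∫ p, F (torusPoint m K p) * torusWeightC m K s p.1 ∂(νA.prod νK)) := by
        rw [hB5]
    _ = ((C₂ * C₅ : ℝ) : ℂ) * ∫ p, torusPairIntegrandC m K (fun g => W (glCorner 𝔸 hmn.le g))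
          (fun g => conj (W' g)) (fun _ => (1 : ℝ)) s p ∂(νA.prod νK) := by
        rw [integral_congr_ae (Eventually.of_forall e7), Complex.ofReal_mul, mul_assoc]

end Main

section Registered

/-- **Registered sub-stub `stub_gap_proj_global_of`** (line `Sketch`, wave 3, lead c6): the closed form of
`exists_const_projected_of` — the global projected theorem granted the two projector unfolding bricks.
[cite: CogdellAnalyticTheory2004, §2.2 (PDF pp. 182–183), Thm. 2.1] -/
theorem stub_gap_proj_global_of :
    ∀ {n m : ℕ} {K : Type} [Field K] [NumberField K]
      [MeasurableSpace (AdeleRing (𝓞 K) K)] [BorelSpace (AdeleRing (𝓞 K) K)] (hm : 0 < m) (hmn : m < n)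
    (μ' : Measure (AdelicGroupData.gl m K).automorphicQuotient) [(AdelicGroupData.gl m K).IsAutomorphicMeasure μ']
    (νA : Measure (Fin m → ideleGroup K)) [IsHaarMeasure νA]
    (νK : Measure ↥(maximalCompactAdelic m K)) [IsHaarMeasure νK]
    (hQU : ∀ (ν : Measure (GL (Fin m) (AdeleRing (𝓞 K) K))) [ν.IsHaarMeasure], ∃ C : ℝ, 0 < C ∧
      ∀ {φ : (AdelicGroupData.gl n K).automorphicQuotient → ℂ},
        IsCuspFormGL n K (isCompact_glFiniteIntegralLevel_holds n K) (invQuot (AdelicGroupData.gl n K) φ) →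
      ∀ {φ' : (AdelicGroupData.gl m K).automorphicQuotient → ℂ},
        IsCuspFormGL m K (isCompact_glFiniteIntegralLevel_holds m K) (invQuot (AdelicGroupData.gl m K) φ') →
      (∀ B : ℝ, 0 < B → ∃ C : ℝ, 0 ≤ C ∧ ∀ h : GL (Fin m) (AdeleRing (𝓞 K) K),
        ‖whittakerDepth m (invQuot (AdelicGroupData.gl n K) φ) (glCorner (AdeleRing (𝓞 K) K) hmn.le h)‖ *
            ‖invQuot (AdelicGroupData.gl m K) φ' h‖ ≤
          C * min ((((glAbsDet m K h : ℝ≥0ˣ) : ℝ≥0) : ℝ) ^ B) ((((glAbsDet m K h : ℝ≥0ˣ) : ℝ≥0) : ℝ) ^ (-B))) →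
      ∀ (β : (AdelicGroupData.gl m K).Adelic → ℝ≥0∞), IsCoveringWeight ↥(AdelicGroupData.gl m K).arithmeticSubgroup β →
      ∀ s : ℂ, jpssProjIntegral hmn μ' φ φ' s =
        (C : ℂ) * ∫ g, whittakerDepth m (invQuot (AdelicGroupData.gl n K) φ) (glCorner (AdeleRing (𝓞 K) K) hmn.le g) *
          invQuot (AdelicGroupData.gl m K) φ' g *
          ((((glAbsDet m K g : ℝ≥0ˣ) : ℝ≥0) : ℝ) : ℂ) ^ (s - ((n : ℂ) - (m : ℂ)) / 2) * ((β g).toReal : ℂ) ∂ν)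
    (hWU : ∀ (ν : Measure (GL (Fin m) (AdeleRing (𝓞 K) K))) [ν.IsHaarMeasure] {Φ : GL (Fin n) (AdeleRing (𝓞 K) K) → ℂ},
      IsCuspFormGL n K (isCompact_glFiniteIntegralLevel_holds n K) Φ →
      ∀ {Θ : GL (Fin m) (AdeleRing (𝓞 K) K) → ℂ}, Measurable Θ → (∀ (γ₀ : GL (Fin m) K) (x : GL (Fin m) (AdeleRing (𝓞 K) K)), Θ (ratGL K γ₀ * x) = Θ x) →
      ∀ {β β' : GL (Fin m) (AdeleRing (𝓞 K) K) → ℝ≥0∞}, Measurable β →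
      (∀ x, coveringSum ↥(ratPoints (⊤ : Subgroup (GL (Fin m) K))) β x = 1) →
      Measurable β' → (∀ x, coveringSum ↥(ratPoints (tailUnipotent m K 0)) β' x = 1) →
      ∫⁻ x, ‖whittakerDepth 0 Φ (glCorner (AdeleRing (𝓞 K) K) hmn.le x) * Θ x‖ₑ * β' x ∂ν < ⊤ →
      ∫ x, whittakerDepth 0 Φ (glCorner (AdeleRing (𝓞 K) K) hmn.le x) * Θ x * ((β' x).toReal : ℂ) ∂ν =
        ∫ x, whittakerDepth m Φ (glCorner (AdeleRing (𝓞 K) K) hmn.le x) * Θ x * ((β x).toReal : ℂ) ∂ν),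
    ∃ C : ℝ, 0 < C ∧
      ∀ {φ : (AdelicGroupData.gl n K).automorphicQuotient → ℂ},
        IsCuspFormGL n K (isCompact_glFiniteIntegralLevel_holds n K) (invQuot (AdelicGroupData.gl n K) φ) →
      ∀ {φ' : (AdelicGroupData.gl m K).automorphicQuotient → ℂ},
        IsCuspFormGL m K (isCompact_glFiniteIntegralLevel_holds m K) (invQuot (AdelicGroupData.gl m K) φ') →
      (∀ B : ℝ, 0 < B → ∃ C : ℝ, 0 ≤ C ∧ ∀ h : GL (Fin m) (AdeleRing (𝓞 K) K),
        ‖whittakerDepth m (invQuot (AdelicGroupData.gl n K) φ) (glCorner (AdeleRing (𝓞 K) K) hmn.le h)‖ *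
            ‖invQuot (AdelicGroupData.gl m K) φ' h‖ ≤
          C * min ((((glAbsDet m K h : ℝ≥0ˣ) : ℝ≥0) : ℝ) ^ B) ((((glAbsDet m K h : ℝ≥0ˣ) : ℝ≥0) : ℝ) ^ (-B))) →
      ∀ (s : ℂ),
        ∫⁻ p, ‖whittakerDepth 0 (invQuot (AdelicGroupData.gl n K) φ) (glCorner (AdeleRing (𝓞 K) K) hmn.le (torusPoint m K p))‖ₑ *
            ENNReal.ofReal (torusWeight m K s.re p.1) ∂(νA.prod νK) < ⊤ →
        jpssProjIntegral hmn μ' φ φ' (s + ((n : ℂ) - (m : ℂ)) / 2) =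
          (C : ℂ) * ∫ p, torusPairIntegrandC m K
            (fun g => whittakerDepth 0 (invQuot (AdelicGroupData.gl n K) φ) (glCorner (AdeleRing (𝓞 K) K) hmn.le g))
            (fun g => conj (whittakerDepth 0 (fun x => conj (invQuot (AdelicGroupData.gl m K) φ' x)) g))
            (fun _ => (1 : ℝ)) s p ∂(νA.prod νK) := by
  intro n m K _ _ _ _ hm hmn μ' _ νA _ νK _ hQU hWU
  exact exists_const_projected_of hm hmn μ' νA νK hQU hWU

end Registered

end Summit.Langlands.Langlands.Theorems.GapProjectedGlobal

end
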